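import Summits.QuantumFields.YangMills.Theorems.SmallFieldWideningLargeFieldMassRefinementTailBoundedRuns

/-!
# Route `SmallFieldWidening` — crux r3 `LargeFieldMassRefinementTail` (stmt-QuantumFields-22884): THE CRUX HOLDS UP TO A RUN HORIZON
# GROWING TO INFINITY — it is exactly an interchange of the refinement limit with the ultraviolet limit
# (support file, leaf; width seat `ym-line-sfw-p2-w3` gen 3, line `birth` v5; the crux stays open)

The companion file `…BoundedRuns` proves the crux's inequality unconditionally for the runs `K ≤ J`, for every FIXED `J`
(`refinedMass_null_boundedRuns`).  A diagonal argument (§1, pure logic on null sequences) upgrades this to a horizon `J(n) → ∞`: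

* §2 **`refinedMass_null_growingRuns`** — for every family `F`, coupling `γ > 0` and profile `b₀ > 0`, `p₀ ≥ 1` there are `J : ℕ → ℕ`
  with `J(n) → ∞` and `δ n → 0` such that `Gibbs^{F.refine n}_K((histGood (F.refine n) θ K 0)ᶜ) ≤ δ n` for every depth `n` with
  `γL^{-n} ≤ 1` and EVERY run `K ≤ J(n)`; **`largeFieldMassRefinementTail_growingRuns`** — the same in the crux's own quantifier shape.

So along the refinements the all-heights small-field event of the first `J(n) → ∞` runs fails with probability `o(1)` — with NO input
beyond the tree's chessboard tail and the crude bounded-height propagation; the crux `LargeFieldMassRefinementTail` is precisely the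
statement that the horizon can be REMOVED (`sup` over all `K` inside the limit `n → ∞`), i.e. that the ultraviolet limit `K → ∞` commutes
with the refinement limit in the large-field mass — the K2 content (uniform control of the block-averaged heights, [Balaban1985UV3] (71)).
The horizon obtained here is inexplicit (diagonal); quantitatively the bounded-height constants of `HistoryTailBoundedHeight` allow
`J(n) ≍ log n` and no more.

WHAT THIS IS NOT: not the crux, no estimate at unbounded height, nothing on the Yang–Mills mass gap (record rung R3 only, not proved here).

References: T. Bałaban, CMP 102 (1985) 255–275 [Balaban1985UV3] ((7) p.257, (71) p.273).
-/

noncomputable section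

open MeasureTheory Filter Topology
open Literature.MathematicalPhysics.QuantumFieldTheory.Balaban1983to89
open Literature.MathematicalPhysics.QuantumFieldTheory.Balaban1983to89.T3ContinuumYM3Torus
open Literature.MathematicalPhysics.QuantumFieldTheory.Balaban1983to89.T3UnitScaleTilt
open Literature.MathematicalPhysics.QuantumFieldTheory.Balaban1983to89.T3UnitLawDensityEML
open Summit.QuantumFields.YangMills.Theorems.LargeFieldMassRefinementTailBoundedRuns (refinedMass_null_boundedRuns)

namespace Summit.QuantumFields.YangMills.Theorems.LargeFieldMassRefinementTailGrowingRuns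

/-! ## §1 Diagonal lemma: a family of null sequences indexed by `J` is null along SOME horizon `J(n) → ∞` -/

/-- **DIAGONAL LEMMA.**  If `δ J` is a null sequence for every `J : ℕ`, there are a horizon `J(n) → ∞` and ONE null sequence `ε` with
`δ (J n) n ≤ ε n` for all `n`: take `N J` with `δ J n ≤ (J+1)⁻¹` for `n ≥ N J`, `J(n)` = the largest `J ≤ n` with `N J + J ≤ n`, and
`ε n = max (δ (J n) n) 0`. [folklore] -/
theorem exists_horizon_of_null {δ : ℕ → ℕ → ℝ} (hδ : ∀ J, Tendsto (δ J) atTop (𝓝 0)) :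
    ∃ (Jh : ℕ → ℕ) (ε : ℕ → ℝ), Tendsto Jh atTop atTop ∧ Tendsto ε atTop (𝓝 0) ∧ ∀ n, δ (Jh n) n ≤ ε n := by
  classical
  -- thresholds `N J`: beyond them `δ J ≤ (J+1)⁻¹`
  have hN : ∀ J : ℕ, ∃ N : ℕ, ∀ n, N ≤ n → δ J n ≤ ((J : ℝ) + 1)⁻¹ := fun J => by
    have hpos : (0 : ℝ) < ((J : ℝ) + 1)⁻¹ := by positivity
    obtain ⟨N, hN⟩ := eventually_atTop.mp ((hδ J).eventually (Iic_mem_nhds hpos))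
    exact ⟨N, fun n hn => hN n hn⟩
  choose N hN using hN
  -- the horizon
  set Jh : ℕ → ℕ := fun n => Nat.findGreatest (fun J => N J + J ≤ n) n with hJh
  have hJh_spec : ∀ n, N 0 ≤ n → N (Jh n) + Jh n ≤ n := fun n hn => by
    have h := Nat.findGreatest_spec (P := fun J => N J + J ≤ n) (m := 0) (n := n) (Nat.zero_le n) (by simpa using hn)
    simpa [hJh] using h
  have hJh_ge : ∀ J₀ n, N J₀ + J₀ ≤ n → J₀ ≤ Jh n := fun J₀ n hn => by
    have h := Nat.le_findGreatest (P := fun J => N J + J ≤ n) (m := J₀) (n := n) (by omega) hn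
    simpa [hJh] using h
  have hJh_top : Tendsto Jh atTop atTop := by
    refine tendsto_atTop_atTop.mpr fun J₀ => ⟨N J₀ + J₀, fun n hn => hJh_ge J₀ n hn⟩
  refine ⟨Jh, fun n => max (δ (Jh n) n) 0, hJh_top, ?_, fun n => le_max_left _ _⟩
  -- squeeze: `0 ≤ ε n ≤ (J(n)+1)⁻¹` for `n ≥ N 0`
  have hup : Tendsto (fun n => ((Jh n : ℝ) + 1)⁻¹) atTop (𝓝 0) := by
    have h1 : Tendsto (fun n => (Jh n : ℝ) + 1) atTop atTop :=
      tendsto_atTop_add_const_right _ _ (tendsto_natCast_atTop_atTop.comp hJh_top)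
    exact tendsto_inv_atTop_zero.comp h1
  refine tendsto_of_tendsto_of_tendsto_of_le_of_le' tendsto_const_nhds hup
    (Eventually.of_forall fun n => le_max_right _ _) ?_
  filter_upwards [eventually_ge_atTop (N 0)] with n hn
  refine max_le ?_ (inv_nonneg.mpr (by positivity))
  have hsp := hJh_spec n hn
  exact hN (Jh n) n (by omega)

/-! ## §2 The crux up to a growing run horizon -/

/-- **THE CRUX's INEQUALITY FOR THE RUNS `K ≤ J(n)` WITH `J(n) → ∞`, UNCONDITIONALLY** (every family, every `γ > 0`, every profile
`b₀ > 0`, `p₀ ≥ 1`): there are a horizon `J(n) → ∞` and `δ n → 0` with `Gibbs^{F.refine n}_K((histGood (F.refine n) θ K 0)ᶜ) ≤ δ n`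
for all `n` with `γL^{-n} ≤ 1` and all `K ≤ J(n)` — `refinedMass_null_boundedRuns` for every fixed horizon + the diagonal lemma.
The crux is the same with NO horizon (all `K`), which is NOT proved. [cite: Balaban1985UV3, (7) p.257 and (71) p.273] -/
theorem refinedMass_null_growingRuns (F : T3Family) {γ b₀ p₀ : ℝ} (hγ : 0 < γ) (hb₀ : 0 < b₀) (hp₀ : 1 ≤ p₀) :
    ∃ (Jh : ℕ → ℕ) (δ : ℕ → ℝ), Tendsto Jh atTop atTop ∧ Tendsto δ atTop (𝓝 0) ∧
      ∀ n K : ℕ, K ≤ Jh n → γ * ((F.L : ℝ)⁻¹) ^ n ≤ 1 →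
        (gibbsK (F.refine n) ℰp (γ * ((F.L : ℝ)⁻¹) ^ n) K).real
          (histGood (F.refine n) ℰp (θBal (F.refine n).L (γ * ((F.L : ℝ)⁻¹) ^ n) b₀ p₀) K 0)ᶜ ≤ δ n := by
  choose δJ hδJ hmassJ using fun J : ℕ => refinedMass_null_boundedRuns J F hγ hb₀ hp₀
  obtain ⟨Jh, ε, hJh, hε, hdiag⟩ := exists_horizon_of_null hδJ
  exact ⟨Jh, ε, hJh, hε, fun n K hK hle => (hmassJ (Jh n) n K hK hle).trans (hdiag n)⟩

/-- **THE CRUX UP TO A GROWING RUN HORIZON, IN ITS OWN QUANTIFIER SHAPE**: for every `L` there are `b₀ > 0`, `p₀ > 2`, `γ₁ > 0`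
(witnesses `1, 3, 1`) such that every family with `F.L = L` and every `γ > 0` admit a horizon `J(n) → ∞` and `δ n → 0` bounding the
complement mass of the all-heights small-field event of run `K` of `F.refine n` at `γL^{-n} ≤ γ₁` for every `K ≤ J(n)`.
`LargeFieldMassRefinementTail` = this statement with the binder `K ≤ J(n)` replaced by all `K` — the interchange of the refinement limit
`n → ∞` with the ultraviolet limit `K → ∞`, NOT proved here. [cite: Balaban1985UV3, (7) p.257 and (71) p.273] -/
theorem largeFieldMassRefinementTail_growingRuns :
    ∀ L : ℕ, ∃ b₀ p₀ γ₁ : ℝ, 0 < b₀ ∧ 2 < p₀ ∧ 0 < γ₁ ∧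
      ∀ (F : T3Family) (γ : ℝ), F.L = L → 0 < γ →
        ∃ (Jh : ℕ → ℕ) (δ : ℕ → ℝ), Tendsto Jh atTop atTop ∧ Tendsto δ atTop (𝓝 0) ∧
          ∀ n K : ℕ, K ≤ Jh n → γ * ((F.L : ℝ)⁻¹) ^ n ≤ γ₁ →
            (gibbsK (F.refine n) ℰp (γ * ((F.L : ℝ)⁻¹) ^ n) K).real
              (histGood (F.refine n) ℰp (θBal (F.refine n).L (γ * ((F.L : ℝ)⁻¹) ^ n) b₀ p₀) K 0)ᶜ ≤ δ n :=
  fun _ => ⟨1, 3, 1, one_pos, by norm_num, one_pos, fun F _ _ hγ =>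
    refinedMass_null_growingRuns F hγ one_pos (by norm_num)⟩

end Summit.QuantumFields.YangMills.Theorems.LargeFieldMassRefinementTailGrowingRuns

end
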